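import Summits.QuantumFields.YangMills.Theorems.F4SubCurvatureDoorShortRootRigidityPlanarExponentialMoments
import Mathlib
import HarnessLib

/-!
# LINE g20-A «angular type» (crux ⟨stmt-QuantumFields-23035⟩ `ShortRootRigidity`) — rung R-S3c `PlanarInitialAperture` BY NAME

Owner file `Cruxes/ShortRootRigidity/Lines/angular_type_rungs.lean` v3 (planner ym-idea-3 g21, sha16 a8a830bd1d79bc63).  This file restates the
vocabulary `IsPlanarLF`, `HasAperture` and the rung `PlanarInitialAperture` CHARACTER-IDENTICALLY and proves
`planarInitialAperture_holds : PlanarInitialAperture`.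

PROOF (pinning, the planar twin of `…RationalToGeneralConePinning`).  Let `c` be the aperture of the tree theorem
`planarExponentialMoments` (S2, frs-p2 g15) for `k`.  For a planar Laplace–Fourier measure `μ` of `k` and `t ≥ 1/c`, every `y'` with `‖y'‖ ≥ c t ≥ 1`
has `|k y'| ≤ C_k` (boundedness clause of `InPlanarClass`), so S2 at `β = ±(c/2)t` gives `∫ e^{−tE ± (c/2)t p} dμ ≤ 2C_k`, hence
`∫ e^{−t(E − (c/2)|p|)} dμ ≤ 4C_k` for all `t ≥ 1/c`; on the slab `{(c/2)|p| − E ≥ δ}` the integrand is `≥ e^{tδ}`, so the slab is null, and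
`{E < (c/2)|p|}` is a countable union of slabs: `HasAperture μ (c/2)`.

HONEST LABEL: one rung (S) of the OPEN stub (C) `stub_planarSpectralCone`; R-S3a/b/d, (C), ⟨23035⟩, ⟨23125⟩, R2d and the Yang–Mills mass gap
remain OPEN; no summit is proved by a line.  Lead seat `ym-line-sfw-p2` g75 (cell ym-idea-1, free hands).
-/

set_option autoImplicit false

noncomputable section

open MeasureTheory Filter Topology Set
open scoped BigOperators ENNReal

namespace Summit.QuantumFields.YangMills.Theorems.F4SubCurvatureDoorPlanarInitialApertureRegistered

open Summit.QuantumFields.YangMills.Theorems.F4SubCurvatureDoorSliceDensityRegistered (E2)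
open Summit.QuantumFields.YangMills.Theorems.F4SubCurvatureDoorSliceInClassRegistered (InPlanarClass)
open Summit.QuantumFields.YangMills.Theorems.F4SubCurvatureDoorPlanarFrameTimeHolomorphyRegistered (mk2)
open Summit.QuantumFields.YangMills.Theorems.F4SubCurvatureDoorPlanarExponentialMomentsRegistered (planarExponentialMoments)

/-! ## Vocabulary and the rung (character-identical with `Lines/angular_type_rungs.lean` v3) -/

/-- A planar Laplace–Fourier representing measure of the frame-`0` transform of `k` (the binder shape of `PlanarExponentialMoments` and of
`Theorems.F4SubCurvatureDoorShortRootRigidityPlanarNarrowTube.planarNarrowTube`, named). [problem-side vocabulary] -/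
def IsPlanarLF (k : E2 → ℝ) (μ : Measure (ℝ × ℝ)) : Prop :=
  μ (Set.Iio 0 ×ˢ Set.univ) = 0 ∧
    ∀ t : ℝ, 0 < t → Integrable (fun z : ℝ × ℝ => Real.exp (-(t * z.1))) μ ∧
      ∀ x : ℝ, k (mk2 t x) = ∫ z, Real.exp (-(z.1 * t)) * Real.cos (z.2 * x) ∂μ

/-- Aperture `τ` in SUPPORT form: no Laplace–Fourier mass strictly below the cone of slope `τ`. [problem-side vocabulary] -/
def HasAperture (μ : Measure (ℝ × ℝ)) (τ : ℝ) : Prop :=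
  μ {z : ℝ × ℝ | z.1 < τ * |z.2|} = 0

/-- **R-S3c · PlanarInitialAperture** (target, S given the tree: `planarExponentialMoments` ✓ gives moments of aperture `c` bounded by `2M`
for EVERY `t`, and pinning as `t → ∞` (`k` bounded outside the unit disc; pattern `Cruxes/RationalToGeneral/Lines/forward_cone_rungs.lean`
`aperture_of_forall_lt`) converts them into support form). -/
def PlanarInitialAperture : Prop :=
  ∀ k : E2 → ℝ, InPlanarClass k → ∃ c : ℝ, 0 < c ∧ ∀ μ : Measure (ℝ × ℝ), IsPlanarLF k μ → HasAperture μ c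

/-! ## Planar cone pinning -/

/-- The slab `{κ|p| − E ≥ δ}` is null under a `t`-uniform exponential-moment bound. -/
theorem measure_slab_eq_zero (μ : Measure (ℝ × ℝ)) {κ C t₀ δ : ℝ} (hδ : 0 < δ)
    (h : ∀ t : ℝ, t₀ ≤ t → Integrable (fun z : ℝ × ℝ => Real.exp (-(t * z.1) + κ * t * |z.2|)) μ ∧
        ∫ z : ℝ × ℝ, Real.exp (-(t * z.1) + κ * t * |z.2|) ∂μ ≤ C) :
    μ {z : ℝ × ℝ | δ ≤ κ * |z.2| - z.1} = 0 := by
  set S : Set (ℝ × ℝ) := {z | δ ≤ κ * |z.2| - z.1} with hS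
  have hkey : ∀ t : ℝ, t₀ ≤ t → 0 ≤ t → μ S ≤ ENNReal.ofReal (C * Real.exp (-(t * δ))) := by
    intro t ht ht0
    obtain ⟨hint, hle⟩ := h t ht
    have h1 : ENNReal.ofReal (Real.exp (t * δ)) * μ S
        ≤ ∫⁻ z, ENNReal.ofReal (Real.exp (-(t * z.1) + κ * t * |z.2|)) ∂μ := by
      calc ENNReal.ofReal (Real.exp (t * δ)) * μ S = ∫⁻ _ in S, ENNReal.ofReal (Real.exp (t * δ)) ∂μ := by
            rw [setLIntegral_const]
        _ ≤ ∫⁻ z in S, ENNReal.ofReal (Real.exp (-(t * z.1) + κ * t * |z.2|)) ∂μ := by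
            refine setLIntegral_mono' (measurableSet_le measurable_const (by fun_prop)) fun z hz => ?_
            refine ENNReal.ofReal_le_ofReal (Real.exp_le_exp.2 ?_)
            have : δ ≤ κ * |z.2| - z.1 := hz
            nlinarith
        _ ≤ ∫⁻ z, ENNReal.ofReal (Real.exp (-(t * z.1) + κ * t * |z.2|)) ∂μ := setLIntegral_le_lintegral _ _
    have h2 : ∫⁻ z, ENNReal.ofReal (Real.exp (-(t * z.1) + κ * t * |z.2|)) ∂μ ≤ ENNReal.ofReal C := by
      rw [← ofReal_integral_eq_lintegral_ofReal hint (ae_of_all _ fun z => (Real.exp_pos _).le)]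
      exact ENNReal.ofReal_le_ofReal hle
    have h3 := h1.trans h2
    have hpos : 0 < Real.exp (t * δ) := Real.exp_pos _
    calc μ S = (ENNReal.ofReal (Real.exp (t * δ)))⁻¹ * (ENNReal.ofReal (Real.exp (t * δ)) * μ S) := by
          rw [← mul_assoc, ENNReal.inv_mul_cancel (by simpa using hpos) ENNReal.ofReal_ne_top, one_mul]
      _ ≤ (ENNReal.ofReal (Real.exp (t * δ)))⁻¹ * ENNReal.ofReal C := by gcongr
      _ = ENNReal.ofReal (C * Real.exp (-(t * δ))) := by
          rw [← ENNReal.ofReal_inv_of_pos hpos, ← ENNReal.ofReal_mul (inv_nonneg.2 hpos.le), Real.exp_neg]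
          ring_nf
  have htend : Tendsto (fun t : ℝ => ENNReal.ofReal (C * Real.exp (-(t * δ)))) atTop (𝓝 0) := by
    rw [← ENNReal.ofReal_zero]
    refine ENNReal.tendsto_ofReal ?_
    have h1 : Tendsto (fun t : ℝ => Real.exp (-(t * δ))) atTop (𝓝 0) := by
      have : Tendsto (fun t : ℝ => -(t * δ)) atTop atBot :=
        tendsto_neg_atTop_atBot.comp (tendsto_id.atTop_mul_const hδ)
      exact Real.tendsto_exp_atBot.comp this
    simpa using h1.const_mul C
  refine le_antisymm ?_ bot_le
  refine ge_of_tendsto htend ?_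
  rw [eventually_atTop]
  exact ⟨max t₀ 0, fun t ht => hkey t (le_trans (le_max_left _ _) ht) (le_trans (le_max_right _ _) ht)⟩

/-- **Planar cone pinning**: a `t`-uniform bound on `∫ e^{−t(E − κ|p|)} dμ` for large `t` forces `HasAperture μ κ`. -/
theorem hasAperture_of_uniform_bound (μ : Measure (ℝ × ℝ)) {κ : ℝ}
    (h : ∃ C t₀ : ℝ, ∀ t : ℝ, t₀ ≤ t →
        Integrable (fun z : ℝ × ℝ => Real.exp (-(t * z.1) + κ * t * |z.2|)) μ ∧
        ∫ z : ℝ × ℝ, Real.exp (-(t * z.1) + κ * t * |z.2|) ∂μ ≤ C) :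
    HasAperture μ κ := by
  obtain ⟨C, t₀, hCt⟩ := h
  have hslab : ∀ n : ℕ, μ {z : ℝ × ℝ | (1 : ℝ) / (n + 1) ≤ κ * |z.2| - z.1} = 0 := fun n =>
    measure_slab_eq_zero μ (by positivity) hCt
  have hcov : {z : ℝ × ℝ | z.1 < κ * |z.2|} ⊆ ⋃ n : ℕ, {z : ℝ × ℝ | (1 : ℝ) / (n + 1) ≤ κ * |z.2| - z.1} := by
    intro z hz
    simp only [mem_setOf_eq] at hz
    obtain ⟨n, hn⟩ := exists_nat_one_div_lt (sub_pos.2 hz)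
    exact mem_iUnion.2 ⟨n, le_of_lt hn⟩
  exact measure_mono_null hcov (measure_iUnion_null hslab)

/-! ## The rung -/

/-- **RUNG R-S3c (by name): `PlanarInitialAperture`** — aperture `c/2` where `c` is the S2 constant of `planarExponentialMoments`. -/
theorem planarInitialAperture_holds : PlanarInitialAperture := by
  intro k hk
  obtain ⟨c, hc, hmom⟩ := planarExponentialMoments k hk
  obtain ⟨C, hC⟩ := hk.2.1
  refine ⟨c / 2, by positivity, fun μ hμ => ?_⟩
  refine hasAperture_of_uniform_bound μ ⟨2 * C + 2 * C, 1 / c, fun t ht => ?_⟩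
  have ht0 : 0 < t := lt_of_lt_of_le (by positivity) ht
  have hct : 1 ≤ c * t := by
    have := mul_le_mul_of_nonneg_left ht hc.le
    rwa [mul_one_div_cancel hc.ne'] at this
  have hM : ∀ y' : E2, c * t ≤ ‖y'‖ → |k y'| ≤ C := fun y' hy' => hC y' (hct.trans hy')
  have hβ : ∀ β : ℝ, |β| = c / 2 * t → |β| < c * t := fun β hβ => by
    rw [hβ]; nlinarith [mul_pos hc ht0]
  have hplus := hmom μ hμ.1 hμ.2 t (c / 2 * t) ht0 (hβ _ (abs_of_pos (by positivity)))
  have hminus := hmom μ hμ.1 hμ.2 t (-(c / 2 * t)) ht0 (hβ _ (by rw [abs_neg, abs_of_pos (by positivity)]))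
  obtain ⟨hintP, hleP⟩ := hplus
  obtain ⟨hintM, hleM⟩ := hminus
  have hleP := hleP C hM
  have hleM := hleM C hM
  -- `e^{κt|p|} ≤ e^{κtp} + e^{−κtp}`
  have hpt : ∀ z : ℝ × ℝ, Real.exp (-(t * z.1) + c / 2 * t * |z.2|) ≤
      Real.exp (-(t * z.1) + c / 2 * t * z.2) + Real.exp (-(t * z.1) + -(c / 2 * t) * z.2) := by
    intro z
    rcases le_or_gt 0 z.2 with hz | hz
    · rw [abs_of_nonneg hz]; linarith [Real.exp_pos (-(t * z.1) + -(c / 2 * t) * z.2)]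
    · rw [abs_of_neg hz, show c / 2 * t * -z.2 = -(c / 2 * t) * z.2 by ring]
      linarith [Real.exp_pos (-(t * z.1) + c / 2 * t * z.2)]
  have hsum : Integrable (fun z : ℝ × ℝ =>
      Real.exp (-(t * z.1) + c / 2 * t * z.2) + Real.exp (-(t * z.1) + -(c / 2 * t) * z.2)) μ := hintP.add hintM
  have hint : Integrable (fun z : ℝ × ℝ => Real.exp (-(t * z.1) + c / 2 * t * |z.2|)) μ :=
    Integrable.mono' hsum (by fun_prop) (ae_of_all _ fun z => by
      rw [Real.norm_eq_abs, abs_of_pos (Real.exp_pos _)]; exact hpt z)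
  refine ⟨hint, ?_⟩
  calc ∫ z : ℝ × ℝ, Real.exp (-(t * z.1) + c / 2 * t * |z.2|) ∂μ
      ≤ ∫ z : ℝ × ℝ, (Real.exp (-(t * z.1) + c / 2 * t * z.2) + Real.exp (-(t * z.1) + -(c / 2 * t) * z.2)) ∂μ :=
        integral_mono hint hsum hpt
    _ = (∫ z : ℝ × ℝ, Real.exp (-(t * z.1) + c / 2 * t * z.2) ∂μ) +
          ∫ z : ℝ × ℝ, Real.exp (-(t * z.1) + -(c / 2 * t) * z.2) ∂μ := integral_add hintP hintM
    _ ≤ 2 * C + 2 * C := add_le_add hleP hleM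

end Summit.QuantumFields.YangMills.Theorems.F4SubCurvatureDoorPlanarInitialApertureRegistered

end
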